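import Summits.BirchSwinnertonDyer.BirchSwinnertonDyer.Theorems.KimAtThreeKwFrobenius
import Literature.NumberTheory.EllipticCurves.LocalTorsionUnramifiedProofs
import HarnessLib

/-!
# No `p`-torsion in `E(L_w)` at an anomalous good prime, from `E(ℚ_p)[p] = 0`

Helper for the W2 crux `KimAtThreeKolyvagin.DeepLowerAtThreeOffKatoStratum` (good-ANOMALOUS rows of
`stub_additiveDefect`, support statement `FineKatoTauAnomalousThree`): the hypothesis `hT`
(`E(L_w)[p] = 0`) of the lattice lemma `KimAtThreeEulerLatticeOfFrobenius` /
`KimAtThreeKwFrobenius.exists_padicLog_eq_iff_of_frobenius`, discharged on anomalous rows from the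
row hypothesis `E(ℚ_p)[p] = 0` (w2-c4 memo W2C4-ANOMALOUS-PORT-g9 §2 (e)).

Argument (`a_p ≡ 1 mod p`, `e(w∣p) = 1`, `p ≥ 3`): for `P ∈ E(L_w)[p]`, Frobenius annihilation
(`EulerLattice.frobeniusCombination_mem_kernel`) gives `φ²P − a_p·φP + p·P ∈ E₁(L_w)`, i.e.
`φ(φP − P) ∈ E₁(L_w) ∩ E[p] = 0` (`UnramifiedKernelTorsion.eq_zero_of_prime_nsmul_eq_zero_of_mem_kernel`,
AEC VII.3.1/IV.6.1 for unramified `L_w`), so `φP = P`; a `φ`-fixed point has coordinates in the fixed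
field `F` of `φ` (`= ℚ_p` for the Frobenius), where `E(F)[p] = 0`.

* `map_eq_self_of_prime_nsmul_eq_zero` — `φP = P` on `E(L_w)[p]` (modulo `E₁(L_w)[p] = 0`);
* `eq_zero_of_prime_nsmul_eq_zero_of_mem_kernel` — `E₁(L_w)[p] = 0` (unramified, `p ≥ 3`);
* `eq_zero_of_map_eq_self` — a `φ`-fixed `p`-torsion point vanishes if `φ`-fixed scalars descend to
  `F` with `E(F)[p] = 0`;
* `forall_prime_nsmul_eq_zero_of_anomalous` (abstract `φ` on `L_w`) and
  `forall_prime_nsmul_eq_zero_of_frobenius` (global `σ ∈ Aut(L/ℚ)`, `φ = σ_w`) — **`E(L_w)[p] = 0`**;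
* `exists_padicLog_eq_iff_of_frobenius_anomalous` — the lattice lemma
  `log_ω E(L_w) = E_p(σ_w)⁻¹𝒪_w` on an anomalous row with `hT` discharged.

What the consumer supplies: the fixed-field statement `hfix` (elements of `L_w` fixed by `σ_w` lie
in the image of `F = ℚ_v`; for `L = ℚ(ζ_m)` via `CyclotomicCompletionProofs.isGalois_adicCompletion`
and `ord σ = [L_w : ℚ_v]`) and `E(F)[p] = 0` (the row's `E(ℚ₃)[3] = 0`, transported along
`exists_pointAddEquiv_adicCompletion_padic_comp`).

References: Silverman, AEC (2009) VII.3.1, IV.6.1, V.2.3.1; Bloch–Kato (1990) Example 3.11.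
-/

noncomputable section

-- the cell's Theorems namespace repeats the summit name by design (D-0017)
set_option linter.dupNamespace false

open scoped Classical NNReal NumberField
open IsDedekindDomain NumberField
open _root_.WeierstrassCurve Literature.NumberTheory.EllipticCurves
  Literature.NumberTheory.EllipticCurves.FormalGroupChart Literature.NumberTheory.EllipticCurves.EulerLattice
open Literature.NumberTheory.Automorphic
open Summit.BirchSwinnertonDyer.BirchSwinnertonDyer.Theorems.KPort
open Summit.BirchSwinnertonDyer.BirchSwinnertonDyer.Theorems.KimAtThreeEulerLatticeOfFrobenius
open Summit.BirchSwinnertonDyer.BirchSwinnertonDyer.Theorems.KimAtThreeKwFrobenius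

namespace Summit.BirchSwinnertonDyer.BirchSwinnertonDyer.Theorems.KimAtThreeAnomalousTorsion

variable {L : Type} [Field L] [NumberField L] (w : HeightOneSpectrum (𝓞 L))
  (W : WeierstrassCurve ℚ) [W.IsElliptic] [W.IsGloballyMinimal] {p : ℕ} [hp : Fact p.Prime]

omit [W.IsElliptic] in
/-- **At an anomalous good prime, Frobenius fixes the `p`-torsion of `E(L_w)` — modulo
`E₁(L_w)[p] = 0`.**  `W/ℚ` globally minimal, `p ∤ Δ_min(W)`, `a_p ≡ 1 (mod p)`; `w ∋ p` a place of
the number field `L`; `φ` an isometric `ℚ`-algebra endomorphism of `L_w` lifting `x ↦ x^p`.  If the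
kernel of reduction `E₁(L_w)` has no `p`-torsion, then `φ P = P` for every `P ∈ E(L_w)[p]`:
by Frobenius annihilation (`EulerLattice.frobeniusCombination_mem_kernel`)
`φ²P − a_p·φP + p·P ∈ E₁`, and `p·P = 0`, `a_p·φP = φP`, so `φ(φP − P) ∈ E₁(L_w)[p] = 0`.
[cite: SilvermanAEC2009, VII.3 Prop. 3.1 and V.2.3.1] -/
theorem map_eq_self_of_prime_nsmul_eq_zero (hw : ((p : ℕ) : 𝓞 L) ∈ w.asIdeal)
    (hΔ : ¬ (p : ℤ) ∣ minimalDiscriminantInt W)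
    (φ : w.adicCompletion L →ₐ[ℚ] w.adicCompletion L) (hφ : ∀ x, ‖φ x‖ = ‖x‖)
    (hφp : ∀ x : w.adicCompletion L, ‖x‖ ≤ 1 → ‖φ x - x ^ p‖ < 1)
    (hap : (p : ℤ) ∣ W.frobeniusTrace p - 1)
    (hE1 : haveI := isIntegral_baseChange w W
      ∀ Q : (W.baseChange (w.adicCompletion L)).toAffine.Point,
        Q ∈ kernel (NormedField.valuation : Valuation (w.adicCompletion L) ℝ≥0)
          (W.baseChange (w.adicCompletion L)) → p • Q = 0 → Q = 0)
    (P : (W.baseChange (w.adicCompletion L)).toAffine.Point) (hP : p • P = 0) :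
    Affine.Point.map φ P = P := by
  haveI hint := isIntegral_baseChange w W
  have hmem : _ ∈ kernel (NormedField.valuation : Valuation (w.adicCompletion L) ℝ≥0)
      (W.baseChange (w.adicCompletion L)) := frobeniusCombination_mem_kernel w W hw hΔ φ hφ hφp P
  obtain ⟨k, hk⟩ := hap
  have hpP : (p : ℤ) • P = 0 := by rw [natCast_zsmul]; exact hP
  have hpφP : (p : ℤ) • Affine.Point.map φ P = 0 := by
    rw [natCast_zsmul, ← map_nsmul, hP, map_zero]
  have ha : (W.frobeniusTrace p) • Affine.Point.map φ P = Affine.Point.map φ P := by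
    have e : W.frobeniusTrace p = 1 + k * (p : ℤ) := by linear_combination hk
    rw [e, add_zsmul, one_zsmul, mul_zsmul, hpφP, zsmul_zero, add_zero]
  rw [ha, hpP, add_zero] at hmem
  have hSp : p • (Affine.Point.map φ (Affine.Point.map φ P) - Affine.Point.map φ P) = 0 := by
    rw [nsmul_sub, ← map_nsmul, ← map_nsmul, hP, map_zero, map_zero, sub_zero]
  have hS0 := hE1 _ hmem hSp
  exact Affine.Point.map_injective φ (sub_eq_zero.mp hS0)

/-- **`E₁(L_w)[p] = 0` at an unramified `w ∣ p`, `p ≥ 3`, `p ∤ Δ_min(W)`** (the hypothesis `hE1`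
above, from `UnramifiedKernelTorsion.eq_zero_of_prime_nsmul_eq_zero_of_mem_kernel`).
[cite: SilvermanAEC2009, VII.3 Prop. 3.1 and IV.6 Thm. 6.1] -/
theorem eq_zero_of_prime_nsmul_eq_zero_of_mem_kernel (hw : ((p : ℕ) : 𝓞 L) ∈ w.asIdeal)
    (hp3 : 3 ≤ p)
    (hdisc : ∀ x : w.adicCompletion L, ‖x‖ < 1 → ‖x‖ ≤ ‖(p : w.adicCompletion L)‖)
    (Q : (W.baseChange (w.adicCompletion L)).toAffine.Point)
    (hQ : haveI := isIntegral_baseChange w W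
      Q ∈ kernel (NormedField.valuation : Valuation (w.adicCompletion L) ℝ≥0)
        (W.baseChange (w.adicCompletion L)))
    (hpQ : p • Q = 0) : Q = 0 := by
  haveI hint := isIntegral_baseChange w W
  have hp0 : (p : w.adicCompletion L) ≠ 0 := by
    rw [← map_natCast (algebraMap L (w.adicCompletion L)) p]
    exact (_root_.map_ne_zero _).mpr (Nat.cast_ne_zero.mpr hp.out.ne_zero)
  have hp1 : ‖(p : w.adicCompletion L)‖ < 1 := by
    have h := LocalPoints.valuation_natCast_lt_one w hw (p := p)
    rw [LocalPoints.valuation_apply, ← NNReal.coe_lt_coe, coe_nnnorm, NNReal.coe_one] at h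
    exact h
  letI : NontriviallyNormedField (w.adicCompletion L) :=
    NontriviallyNormedField.ofNormNeOne ⟨(p : w.adicCompletion L), hp0, hp1.ne⟩
  exact UnramifiedKernelTorsion.eq_zero_of_prime_nsmul_eq_zero_of_mem_kernel
    (W.baseChange (w.adicCompletion L)) hp3 hp0 hp1 hdisc Q hQ hpQ

omit [W.IsElliptic] [W.IsGloballyMinimal] hp in
/-- **A `φ`-fixed `p`-torsion point of `E(K)` vanishes if `φ`-fixed elements of `K` come from a
subfield `F` with `E(F)[p] = 0`** (coordinates descend to `F`; base change of points is injective).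
[folklore] -/
theorem eq_zero_of_map_eq_self {F K : Type*} [Field F] [Field K] [Algebra ℚ F] [Algebra ℚ K]
    [Algebra F K] [IsScalarTower ℚ F K] (φ : K →ₐ[ℚ] K)
    (hfix : ∀ z : K, φ z = z → z ∈ Set.range (algebraMap F K))
    (hF : ∀ Q : (W.baseChange F).toAffine.Point, p • Q = 0 → Q = 0)
    (P : (W.baseChange K).toAffine.Point) (hφP : Affine.Point.map φ P = P) (hP : p • P = 0) :
    P = 0 := by
  rcases P with _ | ⟨x, y, h⟩
  · rfl
  · rw [Affine.Point.map_some] at hφP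
    simp only [Affine.Point.some.injEq] at hφP
    obtain ⟨x₀, rfl⟩ := hfix x hφP.1
    obtain ⟨y₀, rfl⟩ := hfix y hφP.2
    have h₀ : (W.baseChange F).toAffine.Nonsingular x₀ y₀ :=
      (W.toAffine.baseChange_nonsingular (Algebra.ofId F K).injective x₀ y₀).mp h
    have hQ : Affine.Point.baseChange F K (Affine.Point.some x₀ y₀ h₀) = Affine.Point.some _ _ h := rfl
    have hpQ : p • (Affine.Point.some x₀ y₀ h₀ : (W.baseChange F).toAffine.Point) = 0 := by
      apply Affine.Point.map_injective (f := Algebra.ofId F K)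
      rw [map_nsmul, map_zero]
      exact hQ ▸ hP
    have := hF _ hpQ
    exact absurd this (by simp)

/-- **No `p`-torsion in `E(L_w)` at an anomalous good prime** (`p ≥ 3`, `p ∤ Δ_min`, `a_p ≡ 1 mod p`,
`w ∣ p` unramified): if the `φ`-fixed elements of `L_w` come from a subfield `F` (the fixed field of
the Frobenius `φ = σ_w`, i.e. `ℚ_p`) over which `E(F)[p] = 0`, then `E(L_w)[p] = 0` — the
hypothesis `hT` of `KimAtThreeEulerLatticeOfFrobenius.exists_padicLog_eq_iff_norm_eulerOperator_le`
on the good-anomalous rows. [cite: SilvermanAEC2009, VII.3 Prop. 3.1 and IV.6 Thm. 6.1] -/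
theorem forall_prime_nsmul_eq_zero_of_anomalous (hw : ((p : ℕ) : 𝓞 L) ∈ w.asIdeal) (hp3 : 3 ≤ p)
    (hΔ : ¬ (p : ℤ) ∣ minimalDiscriminantInt W)
    (hdisc : ∀ x : w.adicCompletion L, ‖x‖ < 1 → ‖x‖ ≤ ‖(p : w.adicCompletion L)‖)
    (φ : w.adicCompletion L →ₐ[ℚ] w.adicCompletion L) (hφ : ∀ x, ‖φ x‖ = ‖x‖)
    (hφp : ∀ x : w.adicCompletion L, ‖x‖ ≤ 1 → ‖φ x - x ^ p‖ < 1)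
    (hap : (p : ℤ) ∣ W.frobeniusTrace p - 1)
    {F : Type*} [Field F] [Algebra ℚ F] [Algebra F (w.adicCompletion L)]
    [IsScalarTower ℚ F (w.adicCompletion L)]
    (hfix : ∀ z : w.adicCompletion L, φ z = z → z ∈ Set.range (algebraMap F (w.adicCompletion L)))
    (hF : ∀ Q : (W.baseChange F).toAffine.Point, p • Q = 0 → Q = 0)
    (P : (W.baseChange (w.adicCompletion L)).toAffine.Point) (hP : p • P = 0) : P = 0 :=
  eq_zero_of_map_eq_self W φ hfix hF P
    (map_eq_self_of_prime_nsmul_eq_zero w W hw hΔ φ hφ hφp hap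
      (fun Q hQ hpQ => eq_zero_of_prime_nsmul_eq_zero_of_mem_kernel w W hw hp3 hdisc Q hQ hpQ) P hP) hP

/-! ## From a global Frobenius `σ` (the `KimAtThreeKwFrobenius` currency) -/

section Global

variable {w' : ((Rat.HeightOneSpectrum.primesEquiv (R := 𝓞 ℚ)).symm ⟨p, hp.out⟩).Extension (𝓞 L)}

/-- **`E(L_w)[p] = 0` on a good-anomalous row from a global Frobenius.**  `W/ℚ` globally minimal,
`p ≥ 3`, `p ∤ Δ_min(W)`, `a_p ≡ 1 (mod p)`; `w ∣ p` with `e(w∣p) = 1`; `σ ∈ Aut(L/ℚ)` with `σ • w = w`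
and `σ • a ≡ a^p (mod 𝔭_w)` on `𝓞 L`; if the elements of `L_w` fixed by `σ_w = galAdicCompletionMap σ`
come from a subfield `F` with `E(F)[p] = 0` (`F = ℚ_p`: `E(ℚ_p)[p] = 0` is the row's hypothesis),
then `E(L_w)` has no `p`-torsion. [cite: SilvermanAEC2009, VII.3 Prop. 3.1 and IV.6 Thm. 6.1] -/
theorem forall_prime_nsmul_eq_zero_of_frobenius [he : Fact (w'.1.asIdeal.ramificationIdx (𝓞 ℚ) = 1)]
    (hp3 : 3 ≤ p) (hΔ : ¬ (p : ℤ) ∣ minimalDiscriminantInt W) (hap : (p : ℤ) ∣ W.frobeniusTrace p - 1)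
    (σ : L ≃ₐ[ℚ] L) (hσ : σ • w'.1 = w'.1) (hσp : ∀ a : 𝓞 L, σ • a - a ^ p ∈ w'.1.asIdeal)
    {F : Type*} [Field F] [Algebra ℚ F] [Algebra F (w'.1.adicCompletion L)]
    [IsScalarTower ℚ F (w'.1.adicCompletion L)]
    (hfix : ∀ z : w'.1.adicCompletion L, galAdicCompletionMap σ hσ z = z →
      z ∈ Set.range (algebraMap F (w'.1.adicCompletion L)))
    (hF : ∀ Q : (W.baseChange F).toAffine.Point, p • Q = 0 → Q = 0)
    (P : (W.baseChange (w'.1.adicCompletion L)).toAffine.Point) (hP : p • P = 0) : P = 0 := by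
  obtain ⟨φ, hφ⟩ := exists_algHom_eq_galAdicCompletionMap (p := p) σ hσ
  let φK : w'.1.adicCompletion L →ₐ[ℚ] w'.1.adicCompletion L := (galAdicCompletionMap σ hσ).toRatAlgHom
  have hφK : ∀ x, φK x = Kw.toCompletion p L w' (φ ((Kw.toCompletion p L w').symm x)) := by
    intro x
    rw [hφ, RingEquiv.apply_symm_apply]
    rfl
  exact forall_prime_nsmul_eq_zero_of_anomalous w'.1 W (Kw.prime_mem_asIdeal w') hp3 hΔ
    (norm_le_norm_natCast_of_norm_lt_one p L w') φK
    (norm_conj_eq p L w' φ (norm_map_eq σ hσ φ hφ) φK hφK)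
    (norm_conj_sub_pow_lt p L w' φ (norm_map_sub_pow_lt_one σ hσ φ hφ hσp) φK hφK) hap
    (fun z hz => hfix z hz) hF P hP

/-- **The lattice lemma on a good-ANOMALOUS row, all local hypotheses discharged from global data**:
`W/ℚ` globally minimal, `p ≥ 3`, `p ∤ Δ_min(W)`, `a_p ≡ 1 (mod p)`; `w ∣ p`, `e(w∣p) = 1`; `σ ∈ Aut(L/ℚ)`
the Frobenius of `w` (`σ • w = w`, `σ • a ≡ a^p (mod 𝔭_w)`, `ord σ = f(w∣p)`), whose fixed elements in
`L_w` come from a subfield `F` with `E(F)[p] = 0`; `φ` the transport of `σ` to `K_w`.  Then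
`y ∈ K_w` is a `log_ω P`, `P ∈ E(L_w)`, iff `‖φφy − a_p·φy + p·y‖ ≤ ‖p‖`
(`log_ω E(L_w) = E_p(σ_w)⁻¹𝒪_w`). [cite: BlochKato1990, Example 3.11] [cite: SilvermanAEC2009, VII.3.1, IV.6.1, IV.6.4] -/
theorem exists_padicLog_eq_iff_of_frobenius_anomalous
    [he : Fact (w'.1.asIdeal.ramificationIdx (𝓞 ℚ) = 1)]
    (hp3 : 3 ≤ p) (hΔ : ¬ (p : ℤ) ∣ minimalDiscriminantInt W) (hap : (p : ℤ) ∣ W.frobeniusTrace p - 1)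
    (σ : L ≃ₐ[ℚ] L) (hσ : σ • w'.1 = w'.1) (hσp : ∀ a : 𝓞 L, σ • a - a ^ p ∈ w'.1.asIdeal)
    (hord : orderOf σ = w'.1.asIdeal.inertiaDeg (𝓞 ℚ))
    {F : Type*} [Field F] [Algebra ℚ F] [Algebra F (w'.1.adicCompletion L)]
    [IsScalarTower ℚ F (w'.1.adicCompletion L)]
    (hfix : ∀ z : w'.1.adicCompletion L, galAdicCompletionMap σ hσ z = z →
      z ∈ Set.range (algebraMap F (w'.1.adicCompletion L)))
    (hF : ∀ Q : (W.baseChange F).toAffine.Point, p • Q = 0 → Q = 0)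
    (φ : Kw p L w' →ₐ[ℚ_[p]] Kw p L w')
    (hφ : ∀ y, Kw.toCompletion p L w' (φ y) = galAdicCompletionMap σ hσ (Kw.toCompletion p L w' y))
    (y : Kw p L w') :
    haveI := isIntegral_baseChange w'.1 W
    (∃ P : (W.baseChange (w'.1.adicCompletion L)).toAffine.Point,
      padicLogPointFiniteExt (NormedField.valuation : Valuation (w'.1.adicCompletion L) ℝ≥0)
        (W.baseChange (w'.1.adicCompletion L)) p P = Kw.toCompletion p L w' y) ↔
    ‖φ (φ y) - (W.frobeniusTrace p : Kw p L w') * φ y + (p : Kw p L w') * y‖ ≤ ‖(p : Kw p L w')‖ :=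
  exists_padicLog_eq_iff_of_frobenius W hΔ σ hσ hσp hord φ hφ
    (forall_prime_nsmul_eq_zero_of_frobenius W hp3 hΔ hap σ hσ hσp hfix hF) y

end Global

end Summit.BirchSwinnertonDyer.BirchSwinnertonDyer.Theorems.KimAtThreeAnomalousTorsion
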